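import Literature.NumberTheory.EllipticCurves.HalfIntegralWeightFormsThetaMultiplierProofs
import Mathlib.NumberTheory.GaussSum
import Mathlib.NumberTheory.LegendreSymbol.QuadraticChar.Basic
import Mathlib.Analysis.SpecialFunctions.Complex.CircleAddChar
import HarnessLib

/-!
# The sign of the quadratic Gauss sum, from the transformation law of `θ`

Second step of the proof of Shimura 1973, Theorem 1.7 (`Shimura1973_heckeTSq_mem`): Gauss's
evaluation of the quadratic Gauss sum of an odd prime `p`,

  `G_p = Σ_{x mod p} (x/p) e^{2πi x/p} = ε_p √p`,
  `ε_p = 1` (`p ≡ 1 mod 4`), `ε_p = i` (`p ≡ 3 mod 4`)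

(`legendreGaussSum_eq`; Ireland–Rosen, Ch. 6, §4, Thm. 1), which is what turns the coefficient of
the twisted translates `Σ_h (h/p) f(z + h/p)` produced by the double coset `Γ₀(N) diag(1, p²) Γ₀(N)`
into Shimura's middle term `χ(p) ((-1)^λ n / p) p^{λ-1} a(n)` of `T(p²)`. Mathlib has
`gaussSum_sq` (`G_p² = (-1/p) p`) but not the sign, and the tree's `HalfIntegralWeightGaussSums`,
`HalfIntegralWeightGaussSumsOdd` (generalized sums `G(a, k; c)` and the relative evaluations
`G(a; n) = (a/n) G(1; n)`) leave the sign of `G(1; p)` undetermined as well; here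
`legendreGaussSum p = Σ_x (x/p) e(x/p)` (`= G(1; p)` by counting square roots, not needed below).

## Proof (theta functions; exact, no limiting process)

With `θ(z) = Σ e(n² z)` (`shimuraTheta`) and `ψ_p` the standard additive character of `ℤ/p`:

* `Σ_{x mod p} c(x) θ(z + x/p) = Σ_n e(n² z) Σ_x c(x) ψ_p(n² x)` (`sum_mul_shimuraTheta_vadd`); with
  `c = 1` this is the distribution relation `Σ_x θ(z + x/p) = p θ(p² z)` and with `c = (·/p)` it
  is **(★)** `Σ_x (x/p) θ(z + x/p) = G_p (θ(z) - θ(p²z))` (`sum_quadCharC_shimuraTheta_vadd`).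
* **Fricke side.** For `x ≢ 0` choose `e_x ∈ [1, p)` with `4 e_x x ≡ -1 (mod p)` and put
  `γ_x = ((1 + 4e_x x)/p, x; 4e_x, p) ∈ Γ₀(4)` (`frickeMat`). Then
  `-1/(4p²z) + x/p = γ_x(-1/(4z'))` with `z' = z + e_x/p`, so the transformation law of `θ` at
  `γ_x` (`shimuraTheta_smul_eq_thetaFactor`, step 1) together with `θ(-1/(4z)) = √(-2iz) θ(z)`
  (`shimuraTheta_frickeFour`, Mathlib's `jacobiTheta_S_smul`) gives
  `(x/p) θ(-1/(4p²z) + x/p) = ε_p⁻¹ (-1/p) √p √(-2iz) θ(z + e_x/p)`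
  (`quadCharC_mul_shimuraTheta_fricke`; `(4e_x/p) = (-1/p)(x/p)` and
  `√(pz/z') √(-2iz') = √p √(-2iz)`, `csqrt_fricke`). Summing over `x` with the involution
  `x ↦ -(4x)⁻¹` and the distribution relation:
  `Σ_x (x/p) θ(-1/(4p²z) + x/p) = ε_p⁻¹ (-1/p) √p √(-2iz) (p θ(p²z) - θ(z))`.
* (★) at `w = -1/(4p²z)` reads `G_p √(-2iz) (p θ(p²z) - θ(z))` for the same left-hand side, and
  `√(-2iz)(p θ(p² z) - θ(z)) ≠ 0` at `z = i` (`|θ(z) - 1| ≤ 2/15` for `Im z ≥ 1`), so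
  `G_p = ε_p⁻¹ (-1/p) √p = ε_p √p`.

## Main statements

* `legendreGaussSum p` (`= gaussSum` of the quadratic character `quadCharC p` and
  `ZMod.stdAddChar`),
  `legendreGaussSum_eq`: `G_p = ε_p √p` for odd primes `p`.
* `sum_quadCharC_mul_stdAddChar`: `Σ_x (x/p) ψ_p(n² x) = [p ∤ n] G_p`.
* `shimuraTheta_frickeFour`, `sum_shimuraTheta_vadd` (distribution relation),
  `sum_quadCharC_shimuraTheta_vadd` (★), `norm_shimuraTheta_sub_one_le`.

## References

* K. Ireland, M. Rosen, *A classical introduction to modern number theory*, GTM 84, Springer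
  1982, Ch. 6, §4, Theorem 1 (book p. 75). [IrelandRosen1982]
* G. Shimura, *On modular forms of half integral weight*, Ann. of Math. 97 (1973), §1.
  [Shimura1973HalfIntegral]
-/

noncomputable section

open UpperHalfPlane hiding I
open Complex ModularGroup Matrix.SpecialLinearGroup CongruenceSubgroup
open scoped MatrixGroups Real NumberTheorySymbols

namespace Literature.NumberTheory.EllipticCurves.ModularForms

/-! ## Part 2. The sign of the quadratic Gauss sum from the theta transformation law -/

section GaussSum

open ZMod AddChar

/-! ### Square roots: two more branch relations -/

/-- For `X`, `u` with positive real part, `√(X/u) √u = √X`. [folklore] -/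
theorem csqrt_div_mul_csqrt_of_re_pos {X u : ℂ} (hX : 0 < X.re) (hu : 0 < u.re) :
    Complex.sqrt (X / u) * Complex.sqrt u = Complex.sqrt X := by
  have hu0 : u ≠ 0 := by rintro rfl; simp at hu
  have key : ∀ {c : ℂ}, 0 < c.re → |(Complex.sqrt c).im| < (Complex.sqrt c).re := by
    intro c hc
    have h1 : (Complex.sqrt c ^ 2).re = c.re := by rw [csqrt_sq]
    rw [sq, Complex.mul_re] at h1
    have hx := csqrt_re_nonneg c
    have h2 : (Complex.sqrt c).im ^ 2 < (Complex.sqrt c).re ^ 2 := by nlinarith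
    exact abs_lt_of_sq_lt_sq h2 hx
  have hsq : (Complex.sqrt (X / u) * Complex.sqrt u) ^ 2 = Complex.sqrt X ^ 2 := by
    rw [mul_pow, csqrt_sq, csqrt_sq, csqrt_sq, div_mul_cancel₀ X hu0]
  rcases sq_eq_sq_iff_eq_or_eq_neg.mp hsq with h | h
  · exact h
  · exfalso
    have h1 := key hX
    have h2 := key hu
    have hsu0 : Complex.sqrt u ≠ 0 := by
      intro h0; rw [h0] at h2; simp at h2
    have hdiv : Complex.sqrt (X / u) = -(Complex.sqrt X / Complex.sqrt u) := by
      rw [← neg_div, eq_div_iff hsu0, h]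
    have hre := csqrt_re_nonneg (X / u)
    rw [hdiv, Complex.neg_re, Complex.div_re] at hre
    have hn : 0 < Complex.normSq (Complex.sqrt u) := Complex.normSq_pos.mpr hsu0
    -- `Re √X · Re √u + Im √X · Im √u > 0`
    have hpos : 0 < (Complex.sqrt X).re * (Complex.sqrt u).re +
        (Complex.sqrt X).im * (Complex.sqrt u).im := by
      have h3 : |(Complex.sqrt X).im * (Complex.sqrt u).im| <
          (Complex.sqrt X).re * (Complex.sqrt u).re := by
        rw [abs_mul]
        exact mul_lt_mul'' h1 h2 (abs_nonneg _) (abs_nonneg _)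
      have h4 := neg_abs_le ((Complex.sqrt X).im * (Complex.sqrt u).im)
      linarith
    have : (Complex.sqrt X).re * (Complex.sqrt u).re / Complex.normSq (Complex.sqrt u) +
        (Complex.sqrt X).im * (Complex.sqrt u).im / Complex.normSq (Complex.sqrt u) =
        ((Complex.sqrt X).re * (Complex.sqrt u).re + (Complex.sqrt X).im * (Complex.sqrt u).im) /
          Complex.normSq (Complex.sqrt u) := by ring
    rw [this] at hre
    have := div_pos hpos hn
    linarith

/-- `√x = √x` (real) as a complex number, for `x ≥ 0`. [folklore] -/
theorem csqrt_ofReal_nonneg {x : ℝ} (hx : 0 ≤ x) : Complex.sqrt (x : ℂ) = (Real.sqrt x : ℂ) := by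
  rw [Complex.sqrt_of_nonneg (by exact_mod_cast hx)]
  simp

/-- `Re(-2iz) > 0` for `z ∈ ℍ`. [folklore] -/
theorem neg_two_I_mul_re_pos (z : ℍ) : 0 < (-2 * I * (z : ℂ)).re := by
  have h : (-2 * I * (z : ℂ)).re = 2 * z.im := by
    simp [Complex.mul_re, Complex.mul_im]
  rw [h]
  exact mul_pos two_pos z.2

/-- **Branch relation for the Fricke side**: for `z, z' ∈ ℍ` and `p > 0`,
`√(pz/z') · √(-2iz') = √p · √(-2iz)` (both radicands `-2ipz`, `-2iz'` have positive real part).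
[folklore] -/
theorem csqrt_fricke (z z' : ℍ) {p : ℝ} (hp : 0 < p) :
    Complex.sqrt ((p : ℂ) * z / z') * Complex.sqrt (-2 * I * (z' : ℂ)) =
      (Real.sqrt p : ℂ) * Complex.sqrt (-2 * I * (z : ℂ)) := by
  have hz' : (z' : ℂ) ≠ 0 := z'.ne_zero
  have hI : (-2 : ℂ) * I ≠ 0 := mul_ne_zero (by norm_num) I_ne_zero
  have hX : 0 < (-2 * I * ((p : ℂ) * z)).re := by
    have := neg_two_I_mul_re_pos z
    rw [show -2 * I * ((p : ℂ) * z) = (p : ℂ) * (-2 * I * z) by ring, Complex.re_ofReal_mul]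
    exact mul_pos hp this
  rw [show (p : ℂ) * z / z' = (-2 * I * ((p : ℂ) * z)) / (-2 * I * z') by field_simp,
    csqrt_div_mul_csqrt_of_re_pos hX (neg_two_I_mul_re_pos z'),
    show -2 * I * ((p : ℂ) * z) = (p : ℂ) * (-2 * I * z) by ring,
    csqrt_mul_of_re_pos (by simpa using hp) (neg_two_I_mul_re_pos z), csqrt_ofReal_nonneg hp.le]

/-! ### `θ(-1/(4z)) = √(-2iz) θ(z)` -/

/-- The point `-1/(4z) ∈ ℍ` (the Fricke involution `W₄` of level `4`). [folklore] -/
def frickeFour (z : ℍ) : ℍ :=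
  ⟨-1 / (4 * (z : ℂ)), by
    have hz : (z : ℂ) ≠ 0 := z.ne_zero
    rw [show -1 / (4 * (z : ℂ)) = -(4 * (z : ℂ))⁻¹ by rw [neg_div, one_div], Complex.neg_im,
      Complex.inv_im, neg_div, neg_neg]
    apply div_pos
    · simpa using z.2
    · exact Complex.normSq_pos.mpr (mul_ne_zero (by norm_num) hz)⟩

/-- `frickeFour z = -1/(4z)`. [folklore] -/
@[simp] theorem coe_frickeFour (z : ℍ) : ((frickeFour z : ℍ) : ℂ) = -1 / (4 * (z : ℂ)) := rfl

/-- **`θ(-1/(4z)) = √(-2iz) θ(z)`** (`= ϑ(-1/(2z))` with Mathlib's `jacobiTheta_S_smul`).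
[folklore] -/
theorem shimuraTheta_frickeFour (z : ℍ) :
    shimuraTheta (frickeFour z) = Complex.sqrt (-2 * I * (z : ℂ)) * shimuraTheta z := by
  let τ : ℍ := ⟨2 * (z : ℂ), by simpa using z.2⟩
  have hτ : (τ : ℂ) = 2 * (z : ℂ) := rfl
  have hS : ((ModularGroup.S • τ : ℍ) : ℂ) = 2 * ((frickeFour z : ℍ) : ℂ) := by
    rw [modular_S_smul, coe_frickeFour]
    show (-(τ : ℂ))⁻¹ = _
    rw [hτ]
    have hz : (z : ℂ) ≠ 0 := z.ne_zero
    field_simp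
    norm_num
  have h := jacobiTheta_S_smul τ
  rw [hS] at h
  unfold shimuraTheta
  rw [h, hτ, show (1 / 2 : ℂ) = 2⁻¹ by norm_num]
  change Complex.sqrt (-I * (2 * z)) * _ = _
  congr 2
  ring

/-! ### `θ` at rational translates: `Σ_{x mod p} c(x) θ(z + x/p)` as a `q`-series -/

variable {p : ℕ} [Fact p.Prime]

/-- The general term `e(n² z)` of `θ(z)` is summable. [folklore] -/
theorem summable_theta_term (z : ℍ) :
    Summable (fun n : ℤ ↦ cexp (2 * π * I * (n : ℂ) ^ 2 * z)) := by
  have h := (summable_jacobiTheta₂_term_iff 0 (2 * (z : ℂ))).mpr (by simpa using z.2)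
  refine h.congr fun n ↦ ?_
  rw [jacobiTheta₂_term]
  congr 1
  ring

/-- `θ(z + t) = Σ e(n² z) e(n² t)` for real `t`. [folklore] -/
theorem shimuraTheta_vadd_eq_tsum (t : ℝ) (z : ℍ) :
    shimuraTheta (t +ᵥ z) = ∑' n : ℤ, cexp (2 * π * I * (n : ℂ) ^ 2 * z) *
      cexp (2 * π * I * (n : ℂ) ^ 2 * t) := by
  rw [shimuraTheta_eq_tsum, coe_vadd]
  congr 1 with n
  rw [← Complex.exp_add]
  congr 1
  ring

/-- `e(n² x/p) = ψ_p(n² x)` for the standard additive character `ψ_p` of `ℤ/p`. [folklore] -/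
theorem cexp_sq_mul_val_div (n : ℤ) (x : ZMod p) :
    cexp (2 * π * I * (n : ℂ) ^ 2 * (((x.val : ℕ) : ℝ) / (p : ℝ) : ℝ)) =
      stdAddChar (((n : ZMod p) ^ 2) * x) := by
  have : ((n : ZMod p) ^ 2) * x = (((n ^ 2 * (x.val : ℤ) : ℤ)) : ZMod p) := by
    push_cast
    rw [ZMod.natCast_zmod_val]
  rw [this, stdAddChar_coe]
  congr 1
  push_cast
  ring

/-- **`θ` at the rational translates `z + x/p` against coefficients `c(x)`**:
`Σ_{x mod p} c(x) θ(z + x/p) = Σ_n e(n² z) Σ_x c(x) ψ_p(n² x)`. [folklore] -/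
theorem sum_mul_shimuraTheta_vadd (c : ZMod p → ℂ) (z : ℍ) :
    ∑ x : ZMod p, c x * shimuraTheta ((((x.val : ℕ) : ℝ) / (p : ℝ) : ℝ) +ᵥ z) =
      ∑' n : ℤ, cexp (2 * π * I * (n : ℂ) ^ 2 * z) *
        ∑ x : ZMod p, c x * stdAddChar (((n : ZMod p) ^ 2) * x) := by
  have hs := summable_theta_term z
  have hsx : ∀ x : ZMod p, Summable fun n : ℤ ↦
      cexp (2 * π * I * (n : ℂ) ^ 2 * z) * stdAddChar (((n : ZMod p) ^ 2) * x) := by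
    intro x
    refine Summable.of_norm_bounded hs.norm (fun n ↦ ?_)
    rw [norm_mul, stdAddChar_apply, Circle.norm_coe, mul_one]
  simp_rw [shimuraTheta_vadd_eq_tsum, cexp_sq_mul_val_div, ← tsum_mul_left]
  rw [← Summable.tsum_finsetSum (fun x _ ↦ (hsx x).mul_left (c x))]
  congr 1 with n
  rw [Finset.mul_sum]
  congr 1 with x
  ring

/-- The character sums `Σ_x ψ_p(n² x)`: `p` if `p ∣ n`, `0` otherwise. [folklore] -/
theorem sum_stdAddChar_sq_mul (n : ℤ) :
    ∑ x : ZMod p, stdAddChar (((n : ZMod p) ^ 2) * x) =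
      if (p : ℤ) ∣ n then (p : ℂ) else 0 := by
  have hprim := ZMod.isPrimitive_stdAddChar p
  have h := AddChar.sum_mulShift ((n : ZMod p) ^ 2) hprim
  simp_rw [mul_comm _ (((n : ZMod p)) ^ 2)] at h
  rw [h, ZMod.card]
  have hiff : (n : ZMod p) ^ 2 = 0 ↔ (p : ℤ) ∣ n := by
    rw [pow_eq_zero_iff two_ne_zero, ZMod.intCast_zmod_eq_zero_iff_dvd]
  by_cases hd : (p : ℤ) ∣ n
  · rw [if_pos (hiff.mpr hd), if_pos hd]
  · rw [if_neg (fun h0 ↦ hd (hiff.mp h0)), if_neg hd, Nat.cast_zero]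

/-- **Distribution relation**: `Σ_{x mod p} θ(z + x/p) = p θ(p² z)`. [folklore] -/
theorem sum_shimuraTheta_vadd (z : ℍ) (zp : ℍ) (hzp : (zp : ℂ) = (p : ℂ) ^ 2 * z) :
    ∑ x : ZMod p, shimuraTheta ((((x.val : ℕ) : ℝ) / (p : ℝ) : ℝ) +ᵥ z) =
      (p : ℂ) * shimuraTheta zp := by
  have h := sum_mul_shimuraTheta_vadd (fun _ : ZMod p ↦ (1 : ℂ)) z
  simp only [one_mul] at h
  rw [h]
  simp_rw [sum_stdAddChar_sq_mul]
  have hp0 : (p : ℤ) ≠ 0 := by exact_mod_cast (Fact.out : p.Prime).ne_zero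
  -- `Σ_n e(n²z) · p [p ∣ n] = p Σ_m e((pm)² z)`
  rw [shimuraTheta_eq_tsum, hzp, ← tsum_mul_left]
  have hinj : Function.Injective (fun m : ℤ ↦ (p : ℤ) * m) := mul_right_injective₀ hp0
  rw [← hinj.tsum_eq]
  · congr 1 with m
    rw [if_pos (dvd_mul_right _ _)]
    push_cast
    ring_nf
  · intro n hn
    rw [Function.mem_support] at hn
    obtain ⟨m, rfl⟩ : (p : ℤ) ∣ n := by
      by_contra hnd
      exact hn (by simp [hnd])
    exact ⟨m, rfl⟩

end GaussSum

section GaussSum2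

open ZMod AddChar

variable {p : ℕ} [Fact p.Prime]

/-- `Σ_n [p ∣ n] e(n² z) = θ(p² z)`. [folklore] -/
theorem tsum_ite_dvd_theta_term (z zp : ℍ) (hzp : (zp : ℂ) = (p : ℂ) ^ 2 * z) :
    ∑' n : ℤ, (if (p : ℤ) ∣ n then cexp (2 * π * I * (n : ℂ) ^ 2 * z) else 0) =
      shimuraTheta zp := by
  have hp0 : (p : ℤ) ≠ 0 := by exact_mod_cast (Fact.out : p.Prime).ne_zero
  rw [shimuraTheta_eq_tsum, hzp]
  have hinj : Function.Injective (fun m : ℤ ↦ (p : ℤ) * m) := mul_right_injective₀ hp0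
  rw [← hinj.tsum_eq]
  · congr 1 with m
    rw [if_pos (dvd_mul_right _ _)]
    push_cast
    ring_nf
  · intro n hn
    rw [Function.mem_support] at hn
    obtain ⟨m, rfl⟩ : (p : ℤ) ∣ n := by
      by_contra hnd
      exact hn (by simp [hnd])
    exact ⟨m, rfl⟩

variable (p) in
/-- The quadratic character `(·/p)` of `ℤ/p` with complex values. [folklore] -/
def quadCharC : MulChar (ZMod p) ℂ := (quadraticChar (ZMod p)).ringHomComp (Int.castRingHom ℂ)

/-- `quadCharC p x = (x/p)`. [folklore] -/
theorem quadCharC_apply (x : ZMod p) : quadCharC p x = (quadraticChar (ZMod p) x : ℂ) := rfl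

variable (p) in
/-- **The quadratic Gauss sum** `G_p = Σ_{x mod p} (x/p) e^{2πi x/p}` (Mathlib's `gaussSum` of the
quadratic character and the standard additive character of `ℤ/p`). [folklore] -/
def legendreGaussSum : ℂ := gaussSum (quadCharC p) (stdAddChar (N := p))

/-- The quadratic character is nontrivial for odd `p`. [folklore] -/
theorem quadCharC_ne_one (hp : p ≠ 2) : quadCharC p ≠ 1 :=
  (MulChar.ringHomComp_ne_one_iff Int.cast_injective).mpr
    (quadraticChar_ne_one (by rwa [ZMod.ringChar_zmod_n]))

/-- `(x/p)² = 1` for `x ≠ 0`, with complex values. [folklore] -/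
theorem quadCharC_sq_eq_one {x : ZMod p} (hx : x ≠ 0) : quadCharC p x ^ 2 = 1 := by
  rw [quadCharC_apply, ← Int.cast_pow, quadraticChar_sq_one hx, Int.cast_one]

/-- **Twisting**: `Σ_x (x/p) ψ_p(n² x) = G_p` if `p ∤ n` and `0` if `p ∣ n`. [folklore] -/
theorem sum_quadCharC_mul_stdAddChar (hp : p ≠ 2) (n : ℤ) :
    ∑ x : ZMod p, quadCharC p x * stdAddChar (((n : ZMod p)) ^ 2 * x) =
      if (p : ℤ) ∣ n then 0 else legendreGaussSum p := by
  by_cases hd : (p : ℤ) ∣ n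
  · have hn : (n : ZMod p) = 0 := (ZMod.intCast_zmod_eq_zero_iff_dvd n p).mpr hd
    simp_rw [if_pos hd, hn, zero_pow two_ne_zero, zero_mul, map_zero_eq_one, mul_one]
    exact MulChar.sum_eq_zero_of_ne_one (quadCharC_ne_one hp)
  · rw [if_neg hd]
    have hn : (n : ZMod p) ≠ 0 := fun h ↦ hd ((ZMod.intCast_zmod_eq_zero_iff_dvd n p).mp h)
    have hu : IsUnit ((n : ZMod p) ^ 2) := (IsUnit.mk0 _ hn).pow 2
    have h := gaussSum_mulShift_eq (quadCharC p) (stdAddChar (N := p)) hu.unit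
    have hχ : (quadCharC p)⁻¹ (hu.unit : ZMod p) = 1 := by
      rw [MulChar.inv_apply_eq_inv, IsUnit.unit_spec, quadCharC_apply, quadraticChar_sq_one' hn,
        Int.cast_one, Ring.inverse_one]
    rw [hχ, one_mul] at h
    unfold legendreGaussSum
    rw [← h]
    simp only [gaussSum, mulShift_apply, IsUnit.unit_spec]

/-- **(★) `Σ_{x mod p} (x/p) θ(z + x/p) = G_p (θ(z) - θ(p²z))`.** [folklore] -/
theorem sum_quadCharC_shimuraTheta_vadd (hp : p ≠ 2) (z zp : ℍ)
    (hzp : (zp : ℂ) = (p : ℂ) ^ 2 * z) :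
    ∑ x : ZMod p, quadCharC p x * shimuraTheta ((((x.val : ℕ) : ℝ) / (p : ℝ) : ℝ) +ᵥ z) =
      legendreGaussSum p * (shimuraTheta z - shimuraTheta zp) := by
  rw [sum_mul_shimuraTheta_vadd]
  simp_rw [sum_quadCharC_mul_stdAddChar hp]
  have hs := summable_theta_term z
  have hs' : Summable fun n : ℤ ↦
      (if (p : ℤ) ∣ n then cexp (2 * π * I * (n : ℂ) ^ 2 * z) else 0) :=
    Summable.of_norm_bounded hs.norm (fun n ↦ by split_ifs <;> simp)
  rw [← tsum_ite_dvd_theta_term z zp hzp, shimuraTheta_eq_tsum, ← Summable.tsum_sub hs hs',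
    ← tsum_mul_left]
  congr 1 with n
  split_ifs <;> ring

/-! ### The Fricke side: `θ(-1/(4p²z) + x/p)` through the transformation law -/

/-- For `x ≠ 0` in `ℤ/p`: the integer `e_x ∈ [1, p)` with `4 e_x x ≡ -1 (mod p)`. [folklore] -/
def frickeE (x : ZMod p) : ℕ := (-(4 * x)⁻¹ : ZMod p).val

/-- The involution `x ↦ -(4x)⁻¹` of `ℤ/p` (fixing `0`). [folklore] -/
theorem frickeE_cast (x : ZMod p) : ((frickeE x : ℕ) : ZMod p) = -(4 * x)⁻¹ := by
  rw [frickeE, ZMod.natCast_zmod_val]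

/-- `4` is invertible modulo an odd prime. [folklore] -/
theorem four_ne_zero_zmod (hp : p ≠ 2) : (4 : ZMod p) ≠ 0 := by
  have h2 : (2 : ZMod p) ≠ 0 := by
    intro h
    have := (ZMod.natCast_eq_zero_iff 2 p).mp (by exact_mod_cast h)
    have hp' := (Fact.out : p.Prime)
    rcases (Nat.dvd_prime Nat.prime_two).mp this with h1 | h1
    · exact hp'.one_lt.ne' h1
    · exact hp h1
  rw [show (4 : ZMod p) = 2 * 2 by norm_num]
  exact mul_ne_zero h2 h2

/-- `x ↦ -(4x)⁻¹` is an involution of `ℤ/p`. [folklore] -/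
theorem frickeE_involutive (hp : p ≠ 2) :
    Function.Involutive (fun x : ZMod p ↦ (-(4 * x)⁻¹ : ZMod p)) := by
  intro x
  have h4 := four_ne_zero_zmod hp
  by_cases hx : x = 0
  · simp [hx]
  · simp only [mul_inv_rev, mul_neg, inv_neg, inv_inv, neg_neg]
    field_simp

/-- `p ∣ 1 + 4 e_x x` (as integers, `x` represented by `x.val`). [folklore] -/
theorem dvd_one_add_frickeE (hp : p ≠ 2) {x : ZMod p} (hx : x ≠ 0) :
    (p : ℤ) ∣ 1 + 4 * (frickeE x : ℤ) * (x.val : ℤ) := by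
  rw [← ZMod.intCast_zmod_eq_zero_iff_dvd]
  push_cast
  rw [frickeE_cast, ZMod.natCast_zmod_val]
  have h4 := four_ne_zero_zmod hp
  field_simp
  ring

/-- The matrix `γ_x = ((1 + 4e_x x)/p, x; 4e_x, p) ∈ Γ₀(4)` used on the Fricke side. [folklore] -/
def frickeMat (hp : p ≠ 2) (x : ZMod p) (hx : x ≠ 0) : SL(2, ℤ) :=
  ⟨!![(1 + 4 * (frickeE x : ℤ) * (x.val : ℤ)) / p, (x.val : ℤ); 4 * (frickeE x : ℤ), (p : ℤ)], by
    rw [Matrix.det_fin_two_of, Int.ediv_mul_cancel (dvd_one_add_frickeE hp hx)]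
    ring⟩

/-- Entries of `γ_x`. [folklore] -/
theorem frickeMat_apply (hp : p ≠ 2) (x : ZMod p) (hx : x ≠ 0) :
    (frickeMat hp x hx) 1 0 = 4 * (frickeE x : ℤ) ∧ (frickeMat hp x hx) 1 1 = (p : ℤ) ∧
      (frickeMat hp x hx) 0 1 = (x.val : ℤ) ∧
      (frickeMat hp x hx) 0 0 * (p : ℤ) = 1 + 4 * (frickeE x : ℤ) * (x.val : ℤ) := by
  refine ⟨rfl, rfl, rfl, ?_⟩
  show (1 + 4 * (frickeE x : ℤ) * (x.val : ℤ)) / p * (p : ℤ) = _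
  exact Int.ediv_mul_cancel (dvd_one_add_frickeE hp hx)

/-- `γ_x ∈ Γ₀(4)`. [folklore] -/
theorem frickeMat_mem (hp : p ≠ 2) (x : ZMod p) (hx : x ≠ 0) : frickeMat hp x hx ∈ Gamma0 4 := by
  rw [Gamma0_mem, (frickeMat_apply hp x hx).1, ZMod.intCast_zmod_eq_zero_iff_dvd]
  exact dvd_mul_right _ _

end GaussSum2

section GaussSum3

open ZMod AddChar

variable {p : ℕ} [Fact p.Prime]

/-- `(e_x/p) = (-1/p)(x/p)`: from `4 e_x x ≡ -1 (mod p)`. [folklore] -/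
theorem quadraticChar_frickeE (hp : p ≠ 2) {x : ZMod p} (hx : x ≠ 0) :
    (quadraticChar (ZMod p) (frickeE x : ZMod p) : ℂ) =
      quadraticChar (ZMod p) (-1) * quadCharC p x := by
  have h4 := four_ne_zero_zmod hp
  have h2 : (2 : ZMod p) ≠ 0 := fun h ↦ h4 (by rw [show (4 : ZMod p) = 2 * 2 by norm_num, h]; ring)
  rw [quadCharC_apply, ← Int.cast_mul, frickeE_cast]
  congr 1
  -- `χ(-(4x)⁻¹) χ(x) = χ(-1) χ((2⁻¹)²) = χ(-1)`
  have hx2 : quadraticChar (ZMod p) x * quadraticChar (ZMod p) x = 1 := by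
    rw [← sq, quadraticChar_sq_one hx]
  have key : quadraticChar (ZMod p) (-(4 * x)⁻¹) * quadraticChar (ZMod p) x =
      quadraticChar (ZMod p) (-1) := by
    rw [← map_mul, show (-(4 * x)⁻¹ * x : ZMod p) = -1 * (2⁻¹) ^ 2 by field_simp; norm_num,
      map_mul, quadraticChar_sq_one' (inv_ne_zero h2), mul_one]
  calc quadraticChar (ZMod p) (-(4 * x)⁻¹)
      = quadraticChar (ZMod p) (-(4 * x)⁻¹) * (quadraticChar (ZMod p) x *
          quadraticChar (ZMod p) x) := by rw [hx2, mul_one]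
    _ = quadraticChar (ZMod p) (-1) * quadraticChar (ZMod p) x := by rw [← mul_assoc, key]

/-- `(4e/p) = (e/p)` as Shimura symbols, and `= (-1/p)(x/p)`. [folklore] -/
theorem shimuraSymbol_frickeE (hp : p ≠ 2) {x : ZMod p} (hx : x ≠ 0) :
    (shimuraSymbol (4 * (frickeE x : ℤ)) p : ℂ) = quadraticChar (ZMod p) (-1) * quadCharC p x := by
  have hp' : (p : ℤ).natAbs = p := Int.natAbs_natCast p
  rw [shimuraSymbol_of_nonneg (by positivity), hp', jacobiSym.mul_left,
    show (4 : ℤ) = 2 ^ 2 by norm_num, jacobiSym.sq_one' (by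
      change Nat.Coprime 2 p
      exact (Nat.coprime_primes Nat.prime_two (Fact.out : p.Prime)).mpr (Ne.symm hp)), one_mul,
    ← jacobiSym.legendreSym.to_jacobiSym, legendreSym, Int.cast_natCast]
  exact quadraticChar_frickeE hp hx

/-- **The Fricke side, pointwise**: for `x ≢ 0 (mod p)` and `z' = z + e_x/p`,
`-1/(4p²z) + x/p = γ_x(-1/(4z'))`, hence, by the transformation law at `γ_x ∈ Γ₀(4)` and
`θ(-1/(4z')) = √(-2iz') θ(z')`,
`(x/p) θ(-1/(4p²z) + x/p) = ε_p⁻¹ (-1/p) √p √(-2iz) θ(z + e_x/p)`. [folklore] -/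
theorem quadCharC_mul_shimuraTheta_fricke (hp : p ≠ 2) {x : ZMod p} (hx : x ≠ 0) (z zp : ℍ)
    (hzp : (zp : ℂ) = (p : ℂ) ^ 2 * z) :
    quadCharC p x * shimuraTheta ((((x.val : ℕ) : ℝ) / (p : ℝ) : ℝ) +ᵥ frickeFour zp) =
      (thetaEps p)⁻¹ * quadraticChar (ZMod p) (-1) * (Real.sqrt p : ℂ) *
        Complex.sqrt (-2 * I * (z : ℂ)) *
        shimuraTheta ((((frickeE x : ℕ) : ℝ) / (p : ℝ) : ℝ) +ᵥ z) := by
  have hpp : p.Prime := Fact.out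
  have hp0 : (p : ℂ) ≠ 0 := by exact_mod_cast hpp.ne_zero
  have hpR : (0 : ℝ) < p := by exact_mod_cast hpp.pos
  obtain ⟨h10, h11, h01, h00⟩ := frickeMat_apply hp x hx
  set z' : ℍ := ((((frickeE x : ℕ) : ℝ) / (p : ℝ) : ℝ)) +ᵥ z with hz'
  have hz'c : (z' : ℂ) = (z : ℂ) + (frickeE x : ℂ) / p := by
    rw [hz', coe_vadd]; push_cast; ring
  have hz'0 : (z' : ℂ) ≠ 0 := z'.ne_zero
  have hz0 : (z : ℂ) ≠ 0 := z.ne_zero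
  -- the entry `a = (1 + 4 e x)/p` in `ℂ`
  have h00c : (((frickeMat hp x hx) 0 0 : ℤ) : ℂ) * p = 1 + 4 * (frickeE x : ℂ) * (x.val : ℂ) := by
    exact_mod_cast h00
  have ha : (((frickeMat hp x hx) 0 0 : ℤ) : ℂ) = (1 + 4 * (frickeE x : ℂ) * (x.val : ℂ)) / p := by
    rw [eq_div_iff hp0, h00c]
  -- `e = p z' - p z` (polynomial form, to keep denominators simple)
  have hE : (frickeE x : ℂ) = p * z' - p * z := by rw [hz'c]; field_simp; ring
  -- Step A: the two points agree
  have hpt : ((((x.val : ℕ) : ℝ) / (p : ℝ) : ℝ) +ᵥ frickeFour zp) =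
      frickeMat hp x hx • frickeFour z' := by
    apply UpperHalfPlane.ext
    rw [coe_vadd, coe_frickeFour, coe_specialLinearGroup_apply, coe_frickeFour, hzp]
    simp only [h10, h11, h01, eq_intCast]
    push_cast
    rw [ha, hE]
    have hD : (4 : ℂ) * ((p : ℂ) * z' - p * z) * (-1 / (4 * (z' : ℂ))) + p = p * z / z' := by
      field_simp
      ring
    rw [hD, div_div_eq_mul_div]
    field_simp
    ring
  -- Step B: transformation law at `γ ∈ Γ₀(4)` and `θ(-1/(4z')) = √(-2iz') θ(z')`
  rw [hpt, shimuraTheta_smul_eq_thetaFactor (dvd_refl 4) (frickeMat_mem hp x hx), h10, h11,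
    shimuraTheta_frickeFour z']
  unfold thetaFactor
  rw [shimuraSymbol_frickeE hp hx, coe_frickeFour]
  -- Step C: the square roots
  have hrad : ((4 * (frickeE x : ℤ) : ℤ) : ℂ) * (-1 / (4 * (z' : ℂ))) + ((p : ℤ) : ℂ) =
      (p : ℂ) * z / z' := by
    push_cast
    field_simp
    rw [hz'c]
    field_simp
    ring
  rw [hrad]
  have hsq := csqrt_fricke z z' hpR
  push_cast at hsq
  have hxx : quadCharC p x * quadCharC p x = 1 := by rw [← sq, quadCharC_sq_eq_one hx]
  calc quadCharC p x * ((thetaEps p)⁻¹ * (quadraticChar (ZMod p) (-1) * quadCharC p x) *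
        Complex.sqrt ((p : ℂ) * z / z') * (Complex.sqrt (-2 * I * (z' : ℂ)) * shimuraTheta z'))
      = (quadCharC p x * quadCharC p x) * (thetaEps p)⁻¹ * quadraticChar (ZMod p) (-1) *
        (Complex.sqrt ((p : ℂ) * z / z') * Complex.sqrt (-2 * I * (z' : ℂ))) *
        shimuraTheta z' := by ring
    _ = _ := by rw [hxx, hsq, one_mul]; ring

/-- **The Fricke side, summed**:
`Σ_x (x/p) θ(-1/(4p²z) + x/p) = ε_p⁻¹ (-1/p) √p √(-2iz) (p θ(p²z) - θ(z))`
(reindex by the involution `x ↦ -(4x)⁻¹` and use the distribution relation). [folklore] -/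
theorem sum_quadCharC_shimuraTheta_fricke (hp : p ≠ 2) (z zp : ℍ)
    (hzp : (zp : ℂ) = (p : ℂ) ^ 2 * z) :
    ∑ x : ZMod p, quadCharC p x *
        shimuraTheta ((((x.val : ℕ) : ℝ) / (p : ℝ) : ℝ) +ᵥ frickeFour zp) =
      (thetaEps p)⁻¹ * quadraticChar (ZMod p) (-1) * (Real.sqrt p : ℂ) *
        Complex.sqrt (-2 * I * (z : ℂ)) * ((p : ℂ) * shimuraTheta zp - shimuraTheta z) := by
  set C := (thetaEps p)⁻¹ * quadraticChar (ZMod p) (-1) * (Real.sqrt p : ℂ) *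
    Complex.sqrt (-2 * I * (z : ℂ)) with hC
  set φ : ZMod p → ZMod p := fun x ↦ -(4 * x)⁻¹ with hφ
  have hterm : ∀ x : ZMod p, quadCharC p x *
      shimuraTheta ((((x.val : ℕ) : ℝ) / (p : ℝ) : ℝ) +ᵥ frickeFour zp) =
      if x = 0 then 0 else C * shimuraTheta (((((φ x).val : ℕ) : ℝ) / (p : ℝ) : ℝ) +ᵥ z) := by
    intro x
    split_ifs with hx
    · rw [hx, quadCharC_apply, quadraticChar_zero, Int.cast_zero, zero_mul]
    · rw [quadCharC_mul_shimuraTheta_fricke hp hx z zp hzp]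
      rfl
  simp_rw [hterm]
  rw [← Finset.sum_erase_add _ _ (Finset.mem_univ (0 : ZMod p)), if_pos rfl, add_zero,
    Finset.sum_congr rfl (fun x hx ↦ if_neg (Finset.ne_of_mem_erase hx)), ← Finset.mul_sum,
    Finset.sum_erase_eq_sub (Finset.mem_univ _)]
  have hφ0 : φ 0 = 0 := by simp [hφ]
  rw [hφ0, ZMod.val_zero, Nat.cast_zero, zero_div, zero_vadd]
  -- reindex by the involution `φ`
  have hinv := frickeE_involutive (p := p) hp
  have hsum : ∑ x : ZMod p, shimuraTheta (((((φ x).val : ℕ) : ℝ) / (p : ℝ) : ℝ) +ᵥ z) =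
      ∑ y : ZMod p, shimuraTheta ((((y.val : ℕ) : ℝ) / (p : ℝ) : ℝ) +ᵥ z) :=
    Fintype.sum_equiv hinv.toPerm _ _ (fun _ ↦ rfl)
  rw [hsum, sum_shimuraTheta_vadd z zp hzp]

/-- **`|θ(z) - 1| ≤ 2/15` for `Im z ≥ 1`** (`|ϑ(τ) - 1| ≤ 2e^{-π Im τ}/(1 - e^{-π Im τ})` with
`e^{-2π Im z} ≤ e^{-4} ≤ 1/16`). [folklore] -/
theorem norm_shimuraTheta_sub_one_le {z : ℍ} (hz : 1 ≤ z.im) :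
    ‖shimuraTheta z - 1‖ ≤ 2 / 15 := by
  unfold shimuraTheta
  have him : (2 * (z : ℂ)).im = 2 * z.im := by simp
  have hpos : 0 < (2 * (z : ℂ)).im := by rw [him]; linarith [z.2]
  have hb := norm_jacobiTheta_sub_one_le hpos
  rw [him] at hb
  set r := Real.exp (-π * (2 * z.im)) with hr
  have hr0 : 0 < r := Real.exp_pos _
  -- `r ≤ e^{-4} ≤ 1/16`
  have hr1 : r ≤ 1 / 16 := by
    have h4 : 16 ≤ Real.exp 4 := by
      have h1 : (2 : ℝ) ≤ Real.exp 1 := by linarith [Real.add_one_le_exp (1 : ℝ)]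
      have h' : Real.exp 4 = Real.exp 1 ^ 4 := by rw [← Real.exp_nat_mul]; norm_num
      rw [h']
      calc (16 : ℝ) = 2 ^ 4 := by norm_num
        _ ≤ Real.exp 1 ^ 4 := by gcongr
    have hle : -π * (2 * z.im) ≤ -4 := by nlinarith [Real.two_le_pi]
    calc r ≤ Real.exp (-4) := Real.exp_le_exp.mpr hle
      _ = (Real.exp 4)⁻¹ := by rw [Real.exp_neg]
      _ ≤ 1 / 16 := by rw [one_div]; exact inv_anti₀ (by norm_num) h4
  calc ‖jacobiTheta (2 * (z : ℂ)) - 1‖ ≤ 2 / (1 - r) * r := hb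
    _ ≤ 2 / 15 := by
        rw [div_mul_eq_mul_div, div_le_div_iff₀ (by linarith) (by norm_num)]
        nlinarith

/-- `p θ(p²i) - θ(i) ≠ 0`. [folklore] -/
theorem p_mul_shimuraTheta_sub_ne_zero (zp : ℍ) (hzp : (zp : ℂ) = (p : ℂ) ^ 2 * UpperHalfPlane.I) :
    (p : ℂ) * shimuraTheta zp - shimuraTheta UpperHalfPlane.I ≠ 0 := by
  have hpp : p.Prime := Fact.out
  have hp2 : (2 : ℝ) ≤ p := by exact_mod_cast (Fact.out : p.Prime).two_le
  have hzpim : 1 ≤ zp.im := by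
    have : zp.im = (p : ℝ) ^ 2 := by
      rw [← UpperHalfPlane.coe_im, hzp]; simp [sq]
    rw [this]; nlinarith
  have h1 := norm_shimuraTheta_sub_one_le hzpim
  have h2 := norm_shimuraTheta_sub_one_le (z := UpperHalfPlane.I) (by simp)
  intro h0
  have key : (p : ℂ) - 1 =
      -((p : ℂ) * (shimuraTheta zp - 1)) + (shimuraTheta UpperHalfPlane.I - 1) := by
    linear_combination h0
  have hn : ‖(p : ℂ) - 1‖ ≤ p * (2 / 15) + 2 / 15 := by
    rw [key]
    refine (norm_add_le _ _).trans (add_le_add ?_ h2)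
    rw [norm_neg, norm_mul, Complex.norm_natCast]
    exact mul_le_mul_of_nonneg_left h1 (by positivity)
  have hp1 : ‖(p : ℂ) - 1‖ = p - 1 := by
    rw [show (p : ℂ) - 1 = ((p - 1 : ℝ) : ℂ) by push_cast; ring, Complex.norm_real,
      Real.norm_of_nonneg (by linarith)]
  rw [hp1] at hn
  linarith

/-- **The sign of the quadratic Gauss sum** (Gauss; Ireland–Rosen, Ch. 6, §4, Thm. 1): for an odd
prime `p`, `Σ_{x mod p} (x/p) e^{2πi x/p} = ε_p √p`, i.e. `√p` if `p ≡ 1 (mod 4)` and `i√p` if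
`p ≡ 3 (mod 4)`. Proved here from the transformation law of `θ`: compare
`Σ_x (x/p) θ(w + x/p) = G_p (θ(w) - θ(p²w))` at `w = -1/(4p²z)` with its evaluation through
`γ_x ∈ Γ₀(4)` and `θ(-1/(4z)) = √(-2iz) θ(z)`, and cancel the nonzero factor
`√(-2iz)(p θ(p²z) - θ(z))` at `z = i`. [cite: IrelandRosen1982, Ch. 6 §4 Thm. 1] -/
theorem legendreGaussSum_eq (hp : p ≠ 2) : legendreGaussSum p = thetaEps p * (Real.sqrt p : ℂ) := by
  have hpp := (Fact.out : p.Prime)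
  have hp0 : (p : ℂ) ≠ 0 := by exact_mod_cast hpp.ne_zero
  have hpR : (0 : ℝ) < p := by exact_mod_cast hpp.pos
  -- the two evaluations at `w = -1/(4p²z)`, `z = i`
  set z : ℍ := UpperHalfPlane.I with hz
  let zp : ℍ := ⟨(p : ℂ) ^ 2 * z, by
    show 0 < ((p : ℂ) ^ 2 * z).im
    rw [show ((p : ℂ) ^ 2 * z).im = (p : ℝ) ^ 2 * z.im by simp [sq]]
    exact mul_pos (pow_pos hpR 2) z.2⟩
  have hzp : (zp : ℂ) = (p : ℂ) ^ 2 * z := rfl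
  -- companion point of `w = frickeFour zp` is `frickeFour z`: `p² (-1/(4p²z)) = -1/(4z)`
  have hw : ((frickeFour z : ℍ) : ℂ) = (p : ℂ) ^ 2 * (frickeFour zp : ℍ) := by
    rw [coe_frickeFour, coe_frickeFour, hzp]
    have hz0 : (z : ℂ) ≠ 0 := z.ne_zero
    field_simp
  have hA := sum_quadCharC_shimuraTheta_vadd hp (frickeFour zp) (frickeFour z) hw
  have hB := sum_quadCharC_shimuraTheta_fricke hp z zp hzp
  rw [hA, shimuraTheta_frickeFour, shimuraTheta_frickeFour, hzp] at hB
  -- `√(-2i p² z) = p √(-2iz)`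
  have hsq : Complex.sqrt (-2 * I * ((p : ℂ) ^ 2 * z)) =
      (p : ℂ) * Complex.sqrt (-2 * I * (z : ℂ)) := by
    rw [show -2 * I * ((p : ℂ) ^ 2 * z) = ((p : ℂ) ^ 2) * (-2 * I * z) by ring,
      csqrt_mul_of_re_pos
        (by rw [show ((p : ℂ) ^ 2).re = (p : ℝ) ^ 2 by simp [sq]]; exact pow_pos hpR 2)
        (neg_two_I_mul_re_pos z),
      show ((p : ℂ) ^ 2) = (((p : ℝ) ^ 2 : ℝ) : ℂ) by push_cast; ring,
      csqrt_ofReal_nonneg (by positivity),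
      Real.sqrt_sq hpR.le, Complex.ofReal_natCast]
  rw [hsq] at hB
  -- cancel the nonzero factor `√(-2iz) (p θ(p²z) - θ(z))`
  have hne :
      Complex.sqrt (-2 * I * (z : ℂ)) * ((p : ℂ) * shimuraTheta zp - shimuraTheta z) ≠ 0 := by
    refine mul_ne_zero (fun h0 ↦ ?_) (p_mul_shimuraTheta_sub_ne_zero zp hzp)
    have := neg_two_I_mul_re_pos z
    have h1 : -2 * I * (z : ℂ) = 0 := by rw [← csqrt_sq (-2 * I * (z : ℂ)), h0]; ring
    rw [h1] at this; simp at this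
  have key :
      (legendreGaussSum p - (thetaEps p)⁻¹ * quadraticChar (ZMod p) (-1) * (Real.sqrt p : ℂ)) *
      (Complex.sqrt (-2 * I * (z : ℂ)) * ((p : ℂ) * shimuraTheta zp - shimuraTheta z)) = 0 := by
    linear_combination hB
  rw [mul_eq_zero, sub_eq_zero] at key
  rcases key with key | key
  · rw [key, quadraticChar_neg_one (by rwa [ZMod.ringChar_zmod_n]), ZMod.card p]
    -- `ε_p⁻¹ χ₄(p) = ε_p`
    have h4 : p % 4 = 1 ∨ p % 4 = 3 := by
      have hodd : p % 2 = 1 := hpp.eq_two_or_odd.resolve_left hp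
      omega
    unfold thetaEps
    rcases h4 with h4 | h4
    · rw [ZMod.χ₄_nat_one_mod_four h4, if_neg (by omega)]
      simp
    · rw [ZMod.χ₄_nat_three_mod_four h4, if_pos (by omega)]
      simp
  · exact absurd key hne

end GaussSum3

end Literature.NumberTheory.EllipticCurves.ModularForms
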